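import Mathlib.Analysis.Calculus.Gradient.Basic
import Mathlib.Analysis.Calculus.ContDiff.Defs
import Mathlib.Analysis.InnerProductSpace.PiL2
import Mathlib.Analysis.SpecialFunctions.ExpDeriv
import Mathlib.MeasureTheory.Integral.Bochner.Basic
import Mathlib.MeasureTheory.Measure.Haar.OfBasis
import Mathlib.MeasureTheory.Measure.Haar.InnerProductSpace
import HarnessLib

/-!
# The Brascamp–Lieb variance inequality for uniformly log-concave measures

Topic `Literature/Probability/Moments`. Named literature fact (no proof, no `sorry`; consumers take
`(h : BrascampLieb1976_thm41_uniform)` as a hypothesis), vendored for route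
`AtomisticToContinuum/FouriersLaw` · `OddSectorIrreversibility`, support item `CurrentVarianceLinear`
(stmt-AtomisticToContinuum-9143): the equilibrium Gibbs measure of the pinned anharmonic chain has a
uniformly convex potential (`U'' ≥ ω₂ > 0`, `V'' ≥ 1`), and the inequality below bounds the
configurational moments `⟨V'(r_i)²⟩` uniformly in the chain length (apply it to `f = r_i`, then to
`f = r_i^k` recursively).

## The printed theorem

H. J. Brascamp, E. H. Lieb, *On extensions of the Brunn–Minkowski and Prékopa–Leindler theorems,
including inequalities for log concave functions, and with an application to the diffusion
equation*, J. Funct. Anal. **22** (1976) 366–389, **Theorem 4.1**: let `F(x) = exp(-V(x))` on `ℝⁿ`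
with `V ∈ C²` strictly convex; then for `f ∈ C¹` with finite variance,
`∫ |f - ⟨f⟩|² F dx ≤ ∫ ⟨∇f, (V'')⁻¹ ∇f⟩ F dx`, where `⟨f⟩ = ∫ f F / ∫ F`.

## What is vendored

The UNIFORMLY CONVEX SPECIAL CASE (weaker than print): if moreover `V'' ≥ λ·1` for some `λ > 0`
then `(V'')⁻¹ ≤ λ⁻¹·1`, so `∫ |f - ⟨f⟩|² e^{-V} ≤ λ⁻¹ ∫ ‖∇f‖² e^{-V}` — the Poincaré inequality with
constant `1/λ` for the (unnormalised) log-concave weight `e^{-V}` (equivalently for the probability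
measure `e^{-V}dx/Z`; both sides scale alike). Uniform convexity is stated in the first-order form
`V y ≥ V x + ⟨∇V x, y - x⟩ + (λ/2)‖y - x‖²`, which for `C²` functions is equivalent to `V'' ≥ λ·1`.
Typed over `EuclideanSpace ℝ (Fin n)` with Mathlib's `gradient`; integrals are Bochner integrals
against Lebesgue measure with the weight written explicitly, under the integrability hypotheses that
make every term a genuine integral. Mathlib has no Brascamp–Lieb / Bakry–Émery inequality
(searched: `BrascampLieb`, `logConcave`, `Poincare` in `Mathlib.MeasureTheory`/`Probability`).
-/

noncomputable section

open MeasureTheory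
open scoped RealInnerProductSpace

namespace Literature.Probability.Moments

/-- **Brascamp–Lieb variance inequality, uniformly convex case** (Brascamp–Lieb 1976, Thm 4.1
with `V'' ≥ λ·1`, hence `(V'')⁻¹ ≤ λ⁻¹·1`): for `V : ℝⁿ → ℝ` of class `C²`, `λ`-uniformly convex
(`V y ≥ V x + ⟨∇V x, y − x⟩ + (λ/2)‖y − x‖²`), with `e^{-V}` integrable, and `f : ℝⁿ → ℝ` of class
`C¹` with `f e^{-V}`, `f² e^{-V}` and `‖∇f‖² e^{-V}` integrable, the variance of `f` under the
weight `e^{-V}` is at most `λ⁻¹ ∫ ‖∇f‖² e^{-V}`: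
`∫ (f x − m)² e^{-V x} dx ≤ λ⁻¹ ∫ ‖∇f x‖² e^{-V x} dx`, `m = (∫ f e^{-V}) / (∫ e^{-V})`.
[cite: BrascampLieb1976, Thm 4.1] -/
def BrascampLieb1976_thm41_uniform : Prop :=
  ∀ (n : ℕ) (V f : EuclideanSpace ℝ (Fin n) → ℝ) (lam : ℝ), 0 < lam →
    ContDiff ℝ 2 V → ContDiff ℝ 1 f →
    (∀ x y : EuclideanSpace ℝ (Fin n),
        V x + ⟪gradient V x, y - x⟫ + lam / 2 * ‖y - x‖ ^ 2 ≤ V y) →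
    Integrable (fun x => Real.exp (-V x)) →
    Integrable (fun x => f x * Real.exp (-V x)) →
    Integrable (fun x => f x ^ 2 * Real.exp (-V x)) →
    Integrable (fun x => ‖gradient f x‖ ^ 2 * Real.exp (-V x)) →
    let m : ℝ := (∫ x, f x * Real.exp (-V x)) / ∫ x, Real.exp (-V x)
    ∫ x, (f x - m) ^ 2 * Real.exp (-V x) ≤
      lam⁻¹ * ∫ x, ‖gradient f x‖ ^ 2 * Real.exp (-V x)

end Literature.Probability.Moments

end
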